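import Summits.Langlands.Langlands.Theses.QuarterDeficit1951
import Literature.NumberTheory.GaloisRepresentations.UnramifiedDatum
import Literature.NumberTheory.GaloisRepresentations.GaloisRepUnramifiedProofs
import Literature.NumberTheory.GaloisRepresentations.ArtinConductorProofs
import Literature.NumberTheory.Automorphic.BCDTTheoremBWildAtThreeDet

/-!
# `IcosahedralSupply` (stmt-Langlands-15899): the pinned `p`-adic Hodge datum is load-bearing

Negative-side lemmas (crux disprover `cdisprove-stmt-Langlands-15899`, 2026-08-16; supports
stmt-Langlands-15899, route `QuarterDeficit1951`).

Hypothesis mutation "replace the PINNED datum `RD.pst ℓ v hv = fontainePstAdicCompletion v ℓ hv`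
(Hilbert's `ε` over `IsFontaineDatum`) by an ARBITRARY datum family `pst ℓ v hv`", i.e. ask for a
proof of the crux that is uniform in the `p`-adic Hodge datum (one using only the structure axioms
of `PstWeilDeligneData`).  The resulting statement is FALSE (`icosahedralSupply_false_without_pin`):
the crux's quantifier `∀ ℓ [prime], 17 ≤ ℓ` includes `ℓ = 1951`, the residue characteristic of the
conductor; the conjuncts "`artinConductorNat ρ = 1951`" and "unramified at every `v ∤ 1951`" force
`ρ` RAMIFIED at the place above `1951` (`not_isUnramifiedAt_of_artinConductorNat`: an everywhere
unramified `ρ` has conductor `1`, tree theorem `artinConductor_eq_top_of_forall_isUnramifiedAt_holds`),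
while for the accepted truncated datum `F̂_nr` (`unramifiedPstWeilDeligneData`, an inhabitant of
`PstWeilDeligneData` satisfying every structure axiom) de Rham ⇔ unramified
(`unramifiedPstWeilDeligneData_isDeRhamFramed_iff`) and local unramifiedness is global
unramifiedness (`GaloisRep.isUnramifiedAt_iff_toLocal_holds`).

Reading for provers/planner.  Since the datum-uniform statement implies the crux (instantiate
`pst` with the pin), this is not a refutation; it says that ANY proof of `IcosahedralSupply` must use
a property of `Classical.epsilon (IsFontaineDatum _)` beyond the structure axioms, i.e. a clause of
`IsFontaineDatum` under `FontaineDatumExists` — and clauses (F1)–(F8) concern only unramified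
representations and the cyclotomic character, never a RAMIFIED finite-image representation.  The
`ℓ = 1951` instance is therefore an unfillable stub as the tree stands; every `ℓ ≠ 1951` instance has
its geometric conjunct for free (`isDeRhamFramed_of_isUnramifiedAt`, any datum).  Repairs: restate
the crux with `ℓ ≠ 1951` (the deciding theorem `closes` uses `ℓ = 17` only), or add the clause
"potentially unramified ⇒ de Rham" to `IsFontaineDatum` (crux idea `fontaine-clause-f9-…`).
-/

noncomputable section

set_option linter.dupNamespace false -- `Summit.Langlands.Langlands` is the mandated namespace (D-0017)

open scoped NumberField
open Field IsDedekindDomain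

namespace Summit.Langlands.Langlands.Theorems.IcosahedralSupply.Negative

open Literature.NumberTheory.GaloisRepresentations Literature.NumberTheory.PAdicHodge

/-! ### The place above `1951` -/

/-- `1951` is a prime `≥ 17`: the crux's quantifier includes the residue characteristic of its own
conductor. [folklore] -/
theorem prime_1951_and_le : Nat.Prime 1951 ∧ 17 ≤ 1951 := by norm_num

/-- There is a place of `ℚ` above `1951`. [folklore] -/
theorem exists_natCast_1951_mem : ∃ w : HeightOneSpectrum (𝓞 ℚ), ((1951 : ℕ) : 𝓞 ℚ) ∈ w.asIdeal :=
  ⟨(Rat.HeightOneSpectrum.primesEquiv (R := 𝓞 ℚ)).symm ⟨1951, prime_1951_and_le.1⟩,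
    (Literature.NumberTheory.EllipticCurves.natCast_mem_asIdeal_iff_eq_primesEquiv_symm _
      prime_1951_and_le.1).2 rfl⟩

/-- A place other than the one above `1951` has residue characteristic `≠ 1951`. [folklore] -/
theorem residueCard_ne_of_ne {v w : HeightOneSpectrum (𝓞 ℚ)} (hw : ((1951 : ℕ) : 𝓞 ℚ) ∈ w.asIdeal)
    (hv : v ≠ w) : v.residueCard ≠ 1951 := by
  set p : Nat.Primes := Rat.HeightOneSpectrum.primesEquiv (R := 𝓞 ℚ) v with hp
  have hvp : v = (Rat.HeightOneSpectrum.primesEquiv (R := 𝓞 ℚ)).symm ⟨p, p.2⟩ := by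
    rw [hp]; simp
  have hmem : ((p : ℕ) : 𝓞 ℚ) ∈ v.asIdeal :=
    (Literature.NumberTheory.EllipticCurves.natCast_mem_asIdeal_iff_eq_primesEquiv_symm v p.2).2 hvp
  rw [Rat.residueCard_eq_of_natCast_mem p.2 hmem]
  intro h1951
  apply hv
  rw [hvp, (Literature.NumberTheory.EllipticCurves.natCast_mem_asIdeal_iff_eq_primesEquiv_symm w
    prime_1951_and_le.1).1 hw]
  congr 1
  exact Subtype.ext h1951

/-! ### Tightness: conductor `1951` forces ramification above `1951` -/

section Tightness

variable {A : Type*} [CommRing A] [TopologicalSpace A] [IsTopologicalRing A] [Nontrivial A] {n : ℕ}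

/-- An everywhere unramified framed representation of `Γ_ℚ` has numerical Artin conductor `1`
(`𝔣(ρ) = ⊤`, tree theorem `artinConductor_eq_top_of_forall_isUnramifiedAt_holds`). [folklore] -/
theorem artinConductorNat_eq_one_of_forall_isUnramifiedAt (ρ : FramedGaloisRep ℚ A n)
    (h : ∀ v : HeightOneSpectrum (𝓞 ℚ), ρ.IsUnramifiedAt v) :
    ρ.toGaloisRep.artinConductorNat = 1 := by
  have htop : ρ.toGaloisRep.artinConductor = ⊤ :=
    GaloisRep.artinConductor_eq_top_of_forall_isUnramifiedAt_holds
      (fun v => (FramedGaloisRep.isUnramifiedAt_toGaloisRep_iff v ρ).2 (h v))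
  rw [GaloisRep.artinConductorNat, htop, Ideal.absNorm_top]

/-- **Tightness.** A framed `ρ : Γ_ℚ → GL_n(A)` with `artinConductorNat ρ = 1951` that is
unramified at every place of residue characteristic `≠ 1951` is RAMIFIED at the place `w` above
`1951` (otherwise it is unramified everywhere and its conductor is `1`). [folklore] -/
theorem not_isUnramifiedAt_of_artinConductorNat (ρ : FramedGaloisRep ℚ A n)
    (hN : ρ.toGaloisRep.artinConductorNat = 1951)
    (hunr : ∀ v : HeightOneSpectrum (𝓞 ℚ), v.residueCard ≠ 1951 → ρ.IsUnramifiedAt v)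
    {w : HeightOneSpectrum (𝓞 ℚ)} (hw : ((1951 : ℕ) : 𝓞 ℚ) ∈ w.asIdeal) :
    ¬ ρ.IsUnramifiedAt w := by
  intro h0
  have hall : ∀ v : HeightOneSpectrum (𝓞 ℚ), ρ.IsUnramifiedAt v := fun v => by
    by_cases hv : v = w
    · rw [hv]; exact h0
    · exact hunr v (residueCard_ne_of_ne hw hv)
  have h1 := artinConductorNat_eq_one_of_forall_isUnramifiedAt ρ hall
  omega

end Tightness

/-! ### Local ↔ global unramifiedness for framed representations (un-framing the proved bridge) -/

/-- Local unramifiedness from global: if `ρ` is unramified at `v` then `ρ|_{Γ_{ℚ_v}}` kills the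
local inertia group (`GaloisRep.isUnramifiedAt_iff_toLocal_holds`). [folklore] -/
theorem isLocallyUnramified_toLocal_of_isUnramifiedAt {ℓ : ℕ} [Fact ℓ.Prime] {n : ℕ}
    (ρ : FramedGaloisRep ℚ (PadicAlgCl ℓ) n) (v : HeightOneSpectrum (𝓞 ℚ))
    (h : ρ.IsUnramifiedAt v) : (ρ.toLocal v).IsLocallyUnramified := by
  intro σ hσ
  have h1 := ((GaloisRep.isUnramifiedAt_iff_toLocal_holds v ρ.toGaloisRep).1
    ((FramedGaloisRep.isUnramifiedAt_toGaloisRep_iff v ρ).2 h)) σ hσ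
  rw [GaloisRep.toLocal_apply] at h1
  rw [FramedGaloisRep.toLocal_apply]
  have h2 : Matrix.toLin' ((ρ (absGaloisRestrict ℚ (v.adicCompletion ℚ) σ) :
      GL (Fin n) (PadicAlgCl ℓ)) : Matrix (Fin n) (Fin n) (PadicAlgCl ℓ)) = Matrix.toLin' 1 := by
    rw [Matrix.toLin'_one]
    refine LinearMap.ext fun w => ?_
    simpa using congr($h1 w)
  exact Units.ext (Matrix.toLin'.injective h2)

/-- Global unramifiedness from local (converse direction of the same bridge). [folklore] -/
theorem isUnramifiedAt_of_isLocallyUnramified_toLocal {ℓ : ℕ} [Fact ℓ.Prime] {n : ℕ}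
    (ρ : FramedGaloisRep ℚ (PadicAlgCl ℓ) n) (v : HeightOneSpectrum (𝓞 ℚ))
    (h : (ρ.toLocal v).IsLocallyUnramified) : ρ.IsUnramifiedAt v := by
  rw [← FramedGaloisRep.isUnramifiedAt_toGaloisRep_iff]
  refine (GaloisRep.isUnramifiedAt_iff_toLocal_holds v ρ.toGaloisRep).2 fun σ hσ => ?_
  have h1 : (ρ.toLocal v) σ = 1 := h σ hσ
  rw [FramedGaloisRep.toLocal_apply] at h1
  rw [GaloisRep.toLocal_apply]
  refine LinearMap.ext fun w => ?_
  rw [FramedRep.toContinuousRep_apply_apply, h1]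
  simp

/-- **Free de Rham clause** (EVERY datum, in particular the pinned one; no `FontaineDatumExists`):
at a place `v` where `ρ` is unramified, `ρ|_{Γ_{ℚ_v}}` is de Rham for any `PstWeilDeligneData`
(structure axiom `isDeRhamWith_of_isLocallyUnramified`).  So at `ℓ ≠ 1951` the geometric conjunct
of the crux costs nothing; only `ℓ = 1951` is at stake below. [folklore] -/
theorem isDeRhamFramed_of_isUnramifiedAt {ℓ : ℕ} [Fact ℓ.Prime] {n : ℕ}
    (ρ : FramedGaloisRep ℚ (PadicAlgCl ℓ) n) (v : HeightOneSpectrum (𝓞 ℚ))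
    (𝔇 : PstWeilDeligneData (v.adicCompletion ℚ) ℓ) (h : ρ.IsUnramifiedAt v) :
    𝔇.IsDeRhamFramed (ρ.toLocal v) :=
  𝔇.isDeRhamFramed_of_isLocallyUnramified (isLocallyUnramified_toLocal_of_isUnramifiedAt ρ v h)

/-! ### The pin is load-bearing: the datum-uniform crux is false -/

/-- **`IcosahedralSupply` cannot be proved uniformly in the `p`-adic Hodge datum.**  The negated
statement is the crux `QuarterDeficit1951.IcosahedralSupply` with `IsGeometricFramed RD ρ` unfolded
and the pinned datum `RD.pst ℓ v hv` replaced by an arbitrary datum family `pst ℓ v hv`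
(universally quantified, outermost; the then-unused `RD` dropped — `ReciprocityData.pst` ignores
it by definition), everything else verbatim; instantiating `pst := fontainePstAdicCompletion`
gives back the crux, so this is a statement about its PROOFS.  Witness: `ℓ = 1951` and the
truncated datum `F̂_nr` installed on the pinned datum's own `ℚ_ℓ`-algebra structure: de Rham for it
means unramified at the place above `1951` (`unramifiedPstWeilDeligneData_isDeRhamFramed_iff`,
`isUnramifiedAt_of_isLocallyUnramified_toLocal`), contradicting
`not_isUnramifiedAt_of_artinConductorNat`.  Hence any proof of the crux needs a clause of
`IsFontaineDatum` about RAMIFIED finite-image representations at `ℓ = 1951`, and (F1)–(F8) contain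
none. [folklore] -/
theorem icosahedralSupply_false_without_pin :
    ¬ ∀ (pst : ∀ (ℓ : ℕ) [Fact ℓ.Prime] (v : HeightOneSpectrum (𝓞 ℚ)),
          ((ℓ : ℕ) : 𝓞 ℚ) ∈ v.asIdeal → PstWeilDeligneData (v.adicCompletion ℚ) ℓ)
        (ℓ : ℕ) [Fact ℓ.Prime], 17 ≤ ℓ →
        ∃ (ι : PadicAlgCl ℓ ≃+* ℂ) (ρ : FramedGaloisRep ℚ (PadicAlgCl ℓ) 2),
          ((∀ᶠ v : HeightOneSpectrum (𝓞 ℚ) in Filter.cofinite, ρ.IsUnramifiedAt v) ∧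
            ∀ (v : HeightOneSpectrum (𝓞 ℚ)) (hv : ((ℓ : ℕ) : 𝓞 ℚ) ∈ v.asIdeal),
              (pst ℓ v hv).IsDeRhamFramed (ρ.toLocal v)) ∧
          (ρ.toGaloisRep.IsIrreducible ∧ (Set.range ρ).Finite ∧ ρ.IsEven ∧
            ρ.toGaloisRep.artinConductorNat = 1951 ∧
            ∃ χ₀ : DirichletCharacter ℂ 1951, orderOf χ₀ = 5 ∧
              ∀ v : HeightOneSpectrum (𝓞 ℚ), v.residueCard ≠ 1951 →
                ρ.IsUnramifiedAt v ∧ ∃ t d : PadicAlgCl ℓ,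
                  ρ.HasFrobCharpolyAt v
                    (Polynomial.X ^ 2 - Polynomial.C t * Polynomial.X + Polynomial.C d) ∧
                  ι d = (χ₀ (v.residueCard : ZMod 1951))⁻¹ ∧
                  (t ^ 2 = 0 ∨ t ^ 2 = d ∨ t ^ 2 = 4 * d ∨
                    t ^ 4 - 3 * d * t ^ 2 + d ^ 2 = 0)) := by
  intro h
  haveI : Fact (Nat.Prime 1951) := ⟨prime_1951_and_le.1⟩
  obtain ⟨w, hw⟩ := exists_natCast_1951_mem
  obtain ⟨ι, ρ, ⟨-, hdR⟩, -, -, -, hN, χ₀, -, hv⟩ :=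
    h (fun ℓ _ v hv =>
        @unramifiedPstWeilDeligneData (v.adicCompletion ℚ) _ _ _ _ ℓ _
          (fontainePstAdicCompletion v ℓ hv).algebra)
      1951 prime_1951_and_le.2
  have hloc : (ρ.toLocal w).IsLocallyUnramified :=
    (@unramifiedPstWeilDeligneData_isDeRhamFramed_iff (w.adicCompletion ℚ) _ _ _ _ 1951 _
      (fontainePstAdicCompletion w 1951 hw).algebra 2 (ρ.toLocal w)).1 (hdR w hw)
  exact not_isUnramifiedAt_of_artinConductorNat ρ hN (fun v hv' => (hv v hv').1) hw
    (isUnramifiedAt_of_isLocallyUnramified_toLocal ρ w hloc)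

/-! ### What the crux entails at `ℓ = 1951` -/

/-- The crux implies that the PINNED datum at the place `w ∣ 1951` of `ℚ`, `ℓ = 1951`, admits a
de Rham representation of `Γ_{ℚ_w}` which is RAMIFIED (restriction of a finite-image `ρ` of
conductor `1951`): a statement about `Classical.epsilon (IsFontaineDatum _)` that no structure
axiom and no clause (F1)–(F8) delivers — the stub any skeleton on this crux inherits. [folklore] -/
theorem ramified_deRham_of_icosahedralSupply
    (h : Summit.Langlands.Langlands.Theses.QuarterDeficit1951.IcosahedralSupply)
    (RD : Summit.Langlands.ReciprocityData ℚ) {w : HeightOneSpectrum (𝓞 ℚ)}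
    (hw : ((1951 : ℕ) : 𝓞 ℚ) ∈ w.asIdeal) :
    haveI : Fact (Nat.Prime 1951) := ⟨prime_1951_and_le.1⟩
    ∃ ρ : FramedGaloisRep ℚ (PadicAlgCl 1951) 2,
      (Set.range ρ).Finite ∧ ¬ ρ.IsUnramifiedAt w ∧ ¬ (ρ.toLocal w).IsLocallyUnramified ∧
        (fontainePstAdicCompletion w 1951 hw).IsDeRhamFramed (ρ.toLocal w) := by
  haveI : Fact (Nat.Prime 1951) := ⟨prime_1951_and_le.1⟩
  obtain ⟨ι, ρ, ⟨-, hdR⟩, -, hfin, -, hN, χ₀, -, hv⟩ := h RD 1951 prime_1951_and_le.2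
  have hram := not_isUnramifiedAt_of_artinConductorNat ρ hN (fun v hv' => (hv v hv').1) hw
  exact ⟨ρ, hfin, hram, fun hloc => hram (isUnramifiedAt_of_isLocallyUnramified_toLocal ρ w hloc),
    hdR w hw⟩

end Summit.Langlands.Langlands.Theorems.IcosahedralSupply.Negative

end
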